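import Summits.ValiantsHypothesis.ValiantsHypothesis.Theorems.MonotoneRestorationOrbitRestorationQPActionSignCount
import Summits.ValiantsHypothesis.ValiantsHypothesis.Theorems.MonotoneRestorationOrbitRestorationQPTranspositionSigns
import Summits.ValiantsHypothesis.ValiantsHypothesis.Theorems.MonotoneRestorationOrbitRestorationQPKeyedParity
import HarnessLib

/-!
# Negation counts on row/column fibres (ORBIT currency, ΠΣ sub-rung: facts (α), (β), (γ) of the M2′ proof)

Route MonotoneRestoration, crux `OrbitRestorationQP` (stmt-ValiantsHypothesis-18293), line `depth-three-rung`,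
stub A₁ `stub_piSigmaValue`, namespace `Summit.ValiantsHypothesis.ValiantsHypothesis.Theorems.FibreSigns`.

For a matrix-symmetric affine product `f = a·ΠL` with row/column supports `R, C` (`RowColSupport`, `LocalFactors`)
the FIBRE over `(A, B)` is the sub-multiset `{ℓ ∈ L : R ℓ = A, C ℓ = B}`.  The parity proof of rule M2′ (evidence
`A1-M2PRIME-PROOF.md` on the crux item) rests on three facts about the numbers of fibre members NEGATED by the pure row
transposition `ρ = vact rowHom (x y)`, the pure column transposition `κ = vact colHom (x y)` and the diagonal one
`δ = ren (x y) = ρκ`: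

* (α) `rowSupp_eq_pair`, `colSupp_eq_pair` — `ρ ℓ = -ℓ ⇒ R ℓ = {x,y}`; `κ ℓ = -ℓ ⇒ C ℓ = {x,y}` (FACT 1 in canonical form);
* (β) `map_mk_map_row_fibre_eq`, `map_mk_map_col_fibre_eq` — the row action of `σ` carries the fibre over `(A,B)` onto
  the fibre over `(σ•A, B)` up to units (as multisets of associates); columns symmetrically;
* (γ) `even_diag_iff_even_row_add_col` — if `x, y ∈ A ∩ B`, the number of fibre members negated by `δ` has the parity
  of (number negated by `ρ`) + (number negated by `κ`) (sign multiplicativity `δ = ρκ` on the fibre product plus the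
  sign count); `card_diag_eq_card_row` / `card_diag_eq_card_col` — if `{x,y}` lies in `A` and misses `B` (resp. lies in
  `B` and misses `A`) the `δ`- and `ρ`- (resp. `κ`-) negated members coincide; `card_diag_eq_zero_of_*` — no member is
  `δ`-negated if `{x,y}` misses both `A` and `B`, or meets `A` or `B` in exactly one point.

All hypotheses on `R, C, L` are the conclusions of `LocalFactors.exists_rowColSupports_of_matrixSymmetric`.
Everything is proved. [folklore]

## References
* A. Dawar, G. Wilsenach, *Symmetric arithmetic circuits*, ToC 21 (2025), §3.3, Def. 6.1. [DawarWilsenach2025]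
-/

noncomputable section

open scoped Classical Pointwise

-- `Summit.ValiantsHypothesis.ValiantsHypothesis.…` is the tree's single-conjunct layout (Sub = Summit).
set_option linter.dupNamespace false

namespace Summit.ValiantsHypothesis.ValiantsHypothesis.Theorems

namespace FibreSigns

open Equiv Finset ProductAction

variable {n : ℕ}

/-! ### (α) FACT 1 in canonical form -/

/-- **(α), rows.**  If the pure row transposition `(x y)` negates a nonzero `q` of total degree `≤ 1`, then the
canonical row support of `q` is `{x, y}` (`R` any assignment with property (S3) of `RowColSupport`, `n ≥ 9`). [folklore] -/
theorem rowSupp_eq_pair (R : MvPolynomial (Fin n × Fin n) ℂ → Finset (Fin n))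
    (RS3 : ∀ (q : MvPolynomial (Fin n × Fin n) ℂ) (X : Finset (Fin n)), 2 * X.card + 5 ≤ n →
      (∀ τ : Perm (Fin n), (∀ x ∈ X, τ x = x) → vact (K := ℂ) rowHom τ q = q) →
      (R q).card ≤ X.card ∧ ∀ τ : Perm (Fin n), (∀ x ∈ R q, τ x = x) → vact (K := ℂ) rowHom τ q = q)
    (hn : 9 ≤ n) {x y : Fin n} (hxy : x ≠ y) {q : MvPolynomial (Fin n × Fin n) ℂ} (hq0 : q ≠ 0)
    (hq : q.totalDegree ≤ 1) (h : vact (K := ℂ) rowHom (swap x y) q = -q) : R q = {x, y} := by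
  have h2 : (2 : ℂ) ≠ 0 := two_ne_zero
  have hfix2 : ∀ τ : Perm (Fin n), (∀ z ∈ ({x, y} : Finset (Fin n)), τ z = z) → vact (K := ℂ) rowHom τ q = q :=
    fun τ hτ => TranspositionSigns.rowFix_of_swap_neg h2 hq h τ (hτ x (by simp)) (hτ y (by simp))
  obtain ⟨hcard, hR⟩ := RS3 q {x, y} (by rw [card_pair hxy]; omega) hfix2
  rw [card_pair hxy] at hcard
  have hx : x ∈ R q := by
    by_contra hx
    exact hq0 (TranspositionSigns.eq_zero_of_row_swap_neg_of_rowFix h2 hq h hx (by omega) hR)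
  have hy : y ∈ R q := by
    by_contra hy
    rw [swap_comm] at h
    exact hq0 (TranspositionSigns.eq_zero_of_row_swap_neg_of_rowFix h2 hq h hy (by omega) hR)
  symm
  exact eq_of_subset_of_card_le (insert_subset hx (singleton_subset_iff.2 hy)) (by rw [card_pair hxy]; exact hcard)

/-- **(α), columns.**  If the pure column transposition `(x y)` negates a nonzero `q` of total degree `≤ 1`, then the
canonical column support of `q` is `{x, y}`. [folklore] -/
theorem colSupp_eq_pair (C : MvPolynomial (Fin n × Fin n) ℂ → Finset (Fin n))
    (CS3 : ∀ (q : MvPolynomial (Fin n × Fin n) ℂ) (X : Finset (Fin n)), 2 * X.card + 5 ≤ n →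
      (∀ τ : Perm (Fin n), (∀ x ∈ X, τ x = x) → vact (K := ℂ) colHom τ q = q) →
      (C q).card ≤ X.card ∧ ∀ τ : Perm (Fin n), (∀ x ∈ C q, τ x = x) → vact (K := ℂ) colHom τ q = q)
    (hn : 9 ≤ n) {x y : Fin n} (hxy : x ≠ y) {q : MvPolynomial (Fin n × Fin n) ℂ} (hq0 : q ≠ 0)
    (hq : q.totalDegree ≤ 1) (h : vact (K := ℂ) colHom (swap x y) q = -q) : C q = {x, y} := by
  have h2 : (2 : ℂ) ≠ 0 := two_ne_zero
  have hfix2 : ∀ τ : Perm (Fin n), (∀ z ∈ ({x, y} : Finset (Fin n)), τ z = z) → vact (K := ℂ) colHom τ q = q :=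
    fun τ hτ => TranspositionSigns.colFix_of_swap_neg h2 hq h τ (hτ x (by simp)) (hτ y (by simp))
  obtain ⟨hcard, hC⟩ := CS3 q {x, y} (by rw [card_pair hxy]; omega) hfix2
  rw [card_pair hxy] at hcard
  have hx : x ∈ C q := by
    by_contra hx
    exact hq0 (TranspositionSigns.eq_zero_of_col_swap_neg_of_colFix h2 hq h hx (by omega) hC)
  have hy : y ∈ C q := by
    by_contra hy
    rw [swap_comm] at h
    exact hq0 (TranspositionSigns.eq_zero_of_col_swap_neg_of_colFix h2 hq h hy (by omega) hC)
  symm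
  exact eq_of_subset_of_card_le (insert_subset hx (singleton_subset_iff.2 hy)) (by rw [card_pair hxy]; exact hcard)

/-! ### (β) Fibre transport along the row and column actions -/

/-- **(β), rows.**  For `f = a·ΠL ≠ 0` (degree-one factors) invariant under the pure row action, with labels `R`
(row-equivariant) and `C` (row-invariant): the row action of `σ` carries the fibre over `(A, B)` onto the fibre over
`(σ • A, B)`, up to units. [folklore] -/
theorem map_mk_map_row_fibre_eq (R C : MvPolynomial (Fin n × Fin n) ℂ → Finset (Fin n))
    (R1 : ∀ (q : MvPolynomial (Fin n × Fin n) ℂ) (u : ℂ), u ≠ 0 → R (MvPolynomial.C u * q) = R q)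
    (C1 : ∀ (q : MvPolynomial (Fin n × Fin n) ℂ) (u : ℂ), u ≠ 0 → C (MvPolynomial.C u * q) = C q)
    (R2 : ∀ (q : MvPolynomial (Fin n × Fin n) ℂ) (σ : Perm (Fin n)), R (vact (K := ℂ) rowHom σ q) = σ • R q)
    (CR : ∀ (q : MvPolynomial (Fin n × Fin n) ℂ) (σ : Perm (Fin n)), C (vact (K := ℂ) rowHom σ q) = C q)
    {L : Multiset (MvPolynomial (Fin n × Fin n) ℂ)} {a : ℂ}
    (hL1 : ∀ ℓ ∈ L, ℓ.totalDegree = 1) (hf0 : MvPolynomial.C a * L.prod ≠ 0)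
    (hrow : ∀ σ : Perm (Fin n), vact (K := ℂ) rowHom σ (MvPolynomial.C a * L.prod) = MvPolynomial.C a * L.prod)
    (σ : Perm (Fin n)) (A B : Finset (Fin n)) :
    ((L.filter fun ℓ => R ℓ = A ∧ C ℓ = B).map (vact (K := ℂ) rowHom σ)).map Associates.mk =
      (L.filter fun ℓ => R ℓ = σ • A ∧ C ℓ = B).map Associates.mk := by
  have hP : ∀ p q : MvPolynomial (Fin n × Fin n) ℂ, Associated p q →
      ((R p = σ • A ∧ C p = B) ↔ (R q = σ • A ∧ C q = B)) := by
    intro p q hpq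
    obtain ⟨c, hc0, rfl⟩ := SupportBlocks.exists_C_of_associated hpq
    rw [R1 p c hc0, C1 p c hc0]
  have h1 := SupportBlocks.map_mk_filter_eq hP (ActionSignCount.map_mk_map_vact_eq rowHom hL1 hf0 hrow σ)
  have h2 : (L.map (vact (K := ℂ) rowHom σ)).filter (fun ℓ => R ℓ = σ • A ∧ C ℓ = B) =
      (L.filter fun ℓ => R ℓ = A ∧ C ℓ = B).map (vact (K := ℂ) rowHom σ) := by
    rw [Multiset.filter_map]
    congr 1
    refine Multiset.filter_congr fun ℓ _ => ?_
    simp only [Function.comp_apply, R2, CR]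
    constructor
    · rintro ⟨hR, hC⟩; exact ⟨by simpa using congrArg (fun s => σ⁻¹ • s) hR, hC⟩
    · rintro ⟨hR, hC⟩; exact ⟨by rw [hR], hC⟩
  rw [h2] at h1
  exact h1

/-- **(β), columns.**  The column action of `τ` carries the fibre over `(A, B)` onto the fibre over `(A, τ • B)`, up
to units. [folklore] -/
theorem map_mk_map_col_fibre_eq (R C : MvPolynomial (Fin n × Fin n) ℂ → Finset (Fin n))
    (R1 : ∀ (q : MvPolynomial (Fin n × Fin n) ℂ) (u : ℂ), u ≠ 0 → R (MvPolynomial.C u * q) = R q)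
    (C1 : ∀ (q : MvPolynomial (Fin n × Fin n) ℂ) (u : ℂ), u ≠ 0 → C (MvPolynomial.C u * q) = C q)
    (C2 : ∀ (q : MvPolynomial (Fin n × Fin n) ℂ) (τ : Perm (Fin n)), C (vact (K := ℂ) colHom τ q) = τ • C q)
    (RC : ∀ (q : MvPolynomial (Fin n × Fin n) ℂ) (τ : Perm (Fin n)), R (vact (K := ℂ) colHom τ q) = R q)
    {L : Multiset (MvPolynomial (Fin n × Fin n) ℂ)} {a : ℂ}
    (hL1 : ∀ ℓ ∈ L, ℓ.totalDegree = 1) (hf0 : MvPolynomial.C a * L.prod ≠ 0)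
    (hcol : ∀ τ : Perm (Fin n), vact (K := ℂ) colHom τ (MvPolynomial.C a * L.prod) = MvPolynomial.C a * L.prod)
    (τ : Perm (Fin n)) (A B : Finset (Fin n)) :
    ((L.filter fun ℓ => R ℓ = A ∧ C ℓ = B).map (vact (K := ℂ) colHom τ)).map Associates.mk =
      (L.filter fun ℓ => R ℓ = A ∧ C ℓ = τ • B).map Associates.mk := by
  have hP : ∀ p q : MvPolynomial (Fin n × Fin n) ℂ, Associated p q →
      ((R p = A ∧ C p = τ • B) ↔ (R q = A ∧ C q = τ • B)) := by
    intro p q hpq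
    obtain ⟨c, hc0, rfl⟩ := SupportBlocks.exists_C_of_associated hpq
    rw [R1 p c hc0, C1 p c hc0]
  have h1 := SupportBlocks.map_mk_filter_eq hP (ActionSignCount.map_mk_map_vact_eq colHom hL1 hf0 hcol τ)
  have h2 : (L.map (vact (K := ℂ) colHom τ)).filter (fun ℓ => R ℓ = A ∧ C ℓ = τ • B) =
      (L.filter fun ℓ => R ℓ = A ∧ C ℓ = B).map (vact (K := ℂ) colHom τ) := by
    rw [Multiset.filter_map]
    congr 1
    refine Multiset.filter_congr fun ℓ _ => ?_
    simp only [Function.comp_apply, C2, RC]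
    constructor
    · rintro ⟨hR, hC⟩; exact ⟨hR, by simpa using congrArg (fun s => τ⁻¹ • s) hC⟩
    · rintro ⟨hR, hC⟩; exact ⟨hR, by rw [hC]⟩
  rw [h2] at h1
  exact h1

/-! ### (γ) Sign multiplicativity and the other configurations -/

/-- Parities agree when the signs agree: `(-1)^a = (-1)^b` in `ℂ[x]` iff `a ≡ b (mod 2)`. [folklore] -/
theorem even_iff_even_of_neg_one_pow_eq {a b : ℕ}
    (h : ((-1 : MvPolynomial (Fin n × Fin n) ℂ)) ^ a = (-1) ^ b) : (Even a ↔ Even b) := by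
  constructor
  · intro ha
    by_contra hb
    rw [Nat.not_even_iff_odd] at hb
    rw [ha.neg_one_pow, hb.neg_one_pow] at h
    exact SignCount.ne_neg_self (n := n) one_ne_zero h
  · intro hb
    by_contra ha
    rw [Nat.not_even_iff_odd] at ha
    rw [ha.neg_one_pow, hb.neg_one_pow] at h
    exact SignCount.ne_neg_self (n := n) one_ne_zero h.symm

/-- **(γ) SIGN MULTIPLICATIVITY on a fibre.**  Let `x, y ∈ A ∩ B`.  Then the number of members of the fibre over
`(A, B)` negated by the DIAGONAL transposition `(x y)` has the parity of (the number negated by the pure ROW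
transposition) + (the number negated by the pure COLUMN transposition).  [All three involutions map the fibre to itself
up to units; `δ = ρκ` on the fibre product, and the sign count converts signs into parities.] [folklore] -/
theorem even_diag_iff_even_row_add_col (R C : MvPolynomial (Fin n × Fin n) ℂ → Finset (Fin n))
    (R1 : ∀ (q : MvPolynomial (Fin n × Fin n) ℂ) (u : ℂ), u ≠ 0 → R (MvPolynomial.C u * q) = R q)
    (C1 : ∀ (q : MvPolynomial (Fin n × Fin n) ℂ) (u : ℂ), u ≠ 0 → C (MvPolynomial.C u * q) = C q)
    (R2 : ∀ (q : MvPolynomial (Fin n × Fin n) ℂ) (σ : Perm (Fin n)), R (vact (K := ℂ) rowHom σ q) = σ • R q)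
    (RC : ∀ (q : MvPolynomial (Fin n × Fin n) ℂ) (τ : Perm (Fin n)), R (vact (K := ℂ) colHom τ q) = R q)
    (C2 : ∀ (q : MvPolynomial (Fin n × Fin n) ℂ) (τ : Perm (Fin n)), C (vact (K := ℂ) colHom τ q) = τ • C q)
    (CR : ∀ (q : MvPolynomial (Fin n × Fin n) ℂ) (σ : Perm (Fin n)), C (vact (K := ℂ) rowHom σ q) = C q)
    {L : Multiset (MvPolynomial (Fin n × Fin n) ℂ)} {a : ℂ}
    (hL1 : ∀ ℓ ∈ L, ℓ.totalDegree = 1) (hf0 : MvPolynomial.C a * L.prod ≠ 0)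
    (hrow : ∀ σ : Perm (Fin n), vact (K := ℂ) rowHom σ (MvPolynomial.C a * L.prod) = MvPolynomial.C a * L.prod)
    (hcol : ∀ τ : Perm (Fin n), vact (K := ℂ) colHom τ (MvPolynomial.C a * L.prod) = MvPolynomial.C a * L.prod)
    {A B : Finset (Fin n)} {x y : Fin n} (hxA : x ∈ A) (hyA : y ∈ A) (hxB : x ∈ B) (hyB : y ∈ B) :
    Even (Multiset.card ((L.filter fun ℓ => R ℓ = A ∧ C ℓ = B).filter fun ℓ => ren (swap x y) ℓ = -ℓ)) ↔
      Even (Multiset.card ((L.filter fun ℓ => R ℓ = A ∧ C ℓ = B).filter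
              fun ℓ => vact (K := ℂ) rowHom (swap x y) ℓ = -ℓ) +
            Multiset.card ((L.filter fun ℓ => R ℓ = A ∧ C ℓ = B).filter
              fun ℓ => vact (K := ℂ) colHom (swap x y) ℓ = -ℓ)) := by
  set F := L.filter fun ℓ => R ℓ = A ∧ C ℓ = B with hF
  have hF0 : ∀ ℓ ∈ F, ℓ ≠ 0 := fun ℓ hℓ => AffineFactors.ne_zero_of_mem hf0 (Multiset.mem_of_mem_filter hℓ)
  have hP0 : F.prod ≠ 0 := Multiset.prod_ne_zero fun h0 => hF0 0 h0 rfl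
  have hsA : swap x y • A = A := SignFree.swap_smul_finset_eq hxA hyA
  have hsB : swap x y • B = B := SignFree.swap_smul_finset_eq hxB hyB
  -- the three transports of the fibre
  have hmk_row : (F.map (vact (K := ℂ) rowHom (swap x y))).map Associates.mk = F.map Associates.mk := by
    have := map_mk_map_row_fibre_eq R C R1 C1 R2 CR hL1 hf0 hrow (swap x y) A B
    rwa [hsA] at this
  have hmk_col : (F.map (vact (K := ℂ) colHom (swap x y))).map Associates.mk = F.map Associates.mk := by
    have := map_mk_map_col_fibre_eq R C R1 C1 C2 RC hL1 hf0 hcol (swap x y) A B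
    rwa [hsB] at this
  have hinv_row : ∀ p, vact (K := ℂ) rowHom (swap x y) (vact (K := ℂ) rowHom (swap x y) p) = p := fun p => by
    rw [← AlgEquiv.mul_apply, ← map_mul, swap_mul_self, map_one, AlgEquiv.one_apply]
  have hinv_col : ∀ p, vact (K := ℂ) colHom (swap x y) (vact (K := ℂ) colHom (swap x y) p) = p := fun p => by
    rw [← AlgEquiv.mul_apply, ← map_mul, swap_mul_self, map_one, AlgEquiv.one_apply]
  have hrowP := ActionSignCount.prod_map_eq_neg_one_pow_mul (vact (K := ℂ) rowHom (swap x y)) hinv_row F hF0 hmk_row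
  have hcolP := ActionSignCount.prod_map_eq_neg_one_pow_mul (vact (K := ℂ) colHom (swap x y)) hinv_col F hF0 hmk_col
  -- the diagonal transport and sign
  have hfix : ∀ σ : Perm (Fin n), ren σ (MvPolynomial.C a * L.prod) = MvPolynomial.C a * L.prod := fun σ => by
    rw [ren_eq_row_col, hcol, hrow]
  have hmk_diag : (F.map (ren (swap x y))).map Associates.mk = F.map Associates.mk := by
    let lab : MvPolynomial (Fin n × Fin n) ℂ → Finset (Fin n) × Finset (Fin n) := fun q => (R q, C q)
    have hLab1 : ∀ (q : MvPolynomial (Fin n × Fin n) ℂ) (u : ℂ), u ≠ 0 → lab (MvPolynomial.C u * q) = lab q :=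
      fun q u hu => by simp [lab, R1 q u hu, C1 q u hu]
    have hR3 : ∀ (q : MvPolynomial (Fin n × Fin n) ℂ) (σ : Perm (Fin n)), R (ren σ q) = σ • R q := fun q σ => by
      rw [ren_eq_row_col, R2, RC]
    have hC3 : ∀ (q : MvPolynomial (Fin n × Fin n) ℂ) (σ : Perm (Fin n)), C (ren σ q) = σ • C q := fun q σ => by
      rw [ren_eq_row_col, CR, C2]
    have hLab2 : ∀ (q : MvPolynomial (Fin n × Fin n) ℂ) (σ : Perm (Fin n)), lab (ren σ q) = σ • lab q :=
      fun q σ => by simp [lab, hR3, hC3]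
    have hFl : F = L.filter fun ℓ => lab ℓ = (A, B) := Multiset.filter_congr fun ℓ _ => by simp [lab, Prod.ext_iff]
    have hb : swap x y • ((A, B) : Finset (Fin n) × Finset (Fin n)) = (A, B) := by rw [Prod.smul_mk, hsA, hsB]
    rw [hFl]
    exact KeyedParity.map_mk_map_ren_filter_eq lab hLab1 hLab2 hL1 hf0 hfix hb
  have hdiagP := SignCount.prod_map_ren_eq_neg_one_pow_mul (swap x y) (swap_mul_self x y) F hF0 hmk_diag
  -- the three signs on the fibre product
  have hκ : vact (K := ℂ) colHom (swap x y) F.prod =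
      (-1) ^ Multiset.card (F.filter fun ℓ => vact (K := ℂ) colHom (swap x y) ℓ = -ℓ) * F.prod := by
    rw [map_multiset_prod]; exact hcolP
  have hρ : vact (K := ℂ) rowHom (swap x y) F.prod =
      (-1) ^ Multiset.card (F.filter fun ℓ => vact (K := ℂ) rowHom (swap x y) ℓ = -ℓ) * F.prod := by
    rw [map_multiset_prod]; exact hrowP
  have hδ : ren (swap x y) F.prod = (-1) ^ Multiset.card (F.filter fun ℓ => ren (swap x y) ℓ = -ℓ) * F.prod := by
    rw [map_multiset_prod]; exact hdiagP
  -- `δ P = ρ (κ P)`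
  have key : ((-1 : MvPolynomial (Fin n × Fin n) ℂ)) ^ Multiset.card (F.filter fun ℓ => ren (swap x y) ℓ = -ℓ) *
        F.prod =
      (-1) ^ (Multiset.card (F.filter fun ℓ => vact (K := ℂ) colHom (swap x y) ℓ = -ℓ) +
          Multiset.card (F.filter fun ℓ => vact (K := ℂ) rowHom (swap x y) ℓ = -ℓ)) * F.prod := by
    rw [← hδ, ren_eq_row_col, hκ, map_mul, map_pow, map_neg, map_one, hρ, ← mul_assoc, ← pow_add]
  have := even_iff_even_of_neg_one_pow_eq (mul_right_cancel₀ hP0 key)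
  rwa [add_comm] at this

/-- **Configuration (in, out).**  If `x, y ∈ A` and `x, y ∉ B`, the members of the fibre over `(A,B)` negated by the
diagonal transposition are exactly those negated by the pure row transposition (the pure column transposition fixes
every member, its column support missing `x, y`). [folklore] -/
theorem filter_diag_eq_filter_row (R C : MvPolynomial (Fin n × Fin n) ℂ → Finset (Fin n))
    {L : Multiset (MvPolynomial (Fin n × Fin n) ℂ)}
    (hCfix : ∀ ℓ ∈ L, ∀ ρ : Perm (Fin n), (∀ z ∈ C ℓ, ρ z = z) → vact (K := ℂ) colHom ρ ℓ = ℓ)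
    {A B : Finset (Fin n)} {x y : Fin n} (hxB : x ∉ B) (hyB : y ∉ B) :
    ((L.filter fun ℓ => R ℓ = A ∧ C ℓ = B).filter fun ℓ => ren (swap x y) ℓ = -ℓ) =
      ((L.filter fun ℓ => R ℓ = A ∧ C ℓ = B).filter fun ℓ => vact (K := ℂ) rowHom (swap x y) ℓ = -ℓ) := by
  refine Multiset.filter_congr fun ℓ hℓ => ?_
  obtain ⟨hℓL, -, hC⟩ := Multiset.mem_filter.1 hℓ
  have hκ : vact (K := ℂ) colHom (swap x y) ℓ = ℓ := hCfix ℓ hℓL _ fun z hz =>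
    swap_apply_of_ne_of_ne (by rintro rfl; exact hxB (hC ▸ hz)) (by rintro rfl; exact hyB (hC ▸ hz))
  rw [ren_eq_row_col, hκ]

/-- **Configuration (out, in).**  If `x, y ∈ B` and `x, y ∉ A`, the members of the fibre negated by the diagonal
transposition are exactly those negated by the pure column transposition. [folklore] -/
theorem filter_diag_eq_filter_col (R C : MvPolynomial (Fin n × Fin n) ℂ → Finset (Fin n))
    {L : Multiset (MvPolynomial (Fin n × Fin n) ℂ)}
    (hRfix : ∀ ℓ ∈ L, ∀ ρ : Perm (Fin n), (∀ z ∈ R ℓ, ρ z = z) → vact (K := ℂ) rowHom ρ ℓ = ℓ)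
    {A B : Finset (Fin n)} {x y : Fin n} (hxA : x ∉ A) (hyA : y ∉ A) :
    ((L.filter fun ℓ => R ℓ = A ∧ C ℓ = B).filter fun ℓ => ren (swap x y) ℓ = -ℓ) =
      ((L.filter fun ℓ => R ℓ = A ∧ C ℓ = B).filter fun ℓ => vact (K := ℂ) colHom (swap x y) ℓ = -ℓ) := by
  refine Multiset.filter_congr fun ℓ hℓ => ?_
  obtain ⟨hℓL, hR, -⟩ := Multiset.mem_filter.1 hℓ
  have hρ : vact (K := ℂ) rowHom (swap x y) ℓ = ℓ := hRfix ℓ hℓL _ fun z hz =>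
    swap_apply_of_ne_of_ne (by rintro rfl; exact hxA (hR ▸ hz)) (by rintro rfl; exact hyA (hR ▸ hz))
  rw [ren_eq_row_col, RowColSupport.row_col_comm, hρ]

/-- **Configuration (out, out).**  If `x, y` miss both `A` and `B`, no member of the fibre is negated by the diagonal
transposition (it fixes every member). [folklore] -/
theorem filter_diag_eq_zero_of_out_out (R C : MvPolynomial (Fin n × Fin n) ℂ → Finset (Fin n))
    {L : Multiset (MvPolynomial (Fin n × Fin n) ℂ)} {a : ℂ} (hf0 : MvPolynomial.C a * L.prod ≠ 0)
    (hRfix : ∀ ℓ ∈ L, ∀ ρ : Perm (Fin n), (∀ z ∈ R ℓ, ρ z = z) → vact (K := ℂ) rowHom ρ ℓ = ℓ)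
    (hCfix : ∀ ℓ ∈ L, ∀ ρ : Perm (Fin n), (∀ z ∈ C ℓ, ρ z = z) → vact (K := ℂ) colHom ρ ℓ = ℓ)
    {A B : Finset (Fin n)} {x y : Fin n} (hxA : x ∉ A) (hyA : y ∉ A) (hxB : x ∉ B) (hyB : y ∉ B) :
    ((L.filter fun ℓ => R ℓ = A ∧ C ℓ = B).filter fun ℓ => ren (swap x y) ℓ = -ℓ) = 0 := by
  rw [filter_diag_eq_filter_row R C hCfix hxB hyB, Multiset.filter_eq_nil]
  intro ℓ hℓ
  obtain ⟨hℓL, hR, -⟩ := Multiset.mem_filter.1 hℓ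
  have hρ : vact (K := ℂ) rowHom (swap x y) ℓ = ℓ := hRfix ℓ hℓL _ fun z hz =>
    swap_apply_of_ne_of_ne (by rintro rfl; exact hxA (hR ▸ hz)) (by rintro rfl; exact hyA (hR ▸ hz))
  rw [hρ]
  exact SignCount.ne_neg_self (AffineFactors.ne_zero_of_mem hf0 hℓL)

/-- **No diagonal negation when the transposition MOVES the row support**: if exactly one of `x, y` lies in `A`
(so `(x y) • A ≠ A`), no member of the fibre over `(A, B)` is negated by `ren (x y)`. [folklore] -/
theorem filter_diag_eq_zero_of_row_moved (R C : MvPolynomial (Fin n × Fin n) ℂ → Finset (Fin n))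
    (R1 : ∀ (q : MvPolynomial (Fin n × Fin n) ℂ) (u : ℂ), u ≠ 0 → R (MvPolynomial.C u * q) = R q)
    (R3 : ∀ (q : MvPolynomial (Fin n × Fin n) ℂ) (σ : Perm (Fin n)), R (ren σ q) = σ • R q)
    {L : Multiset (MvPolynomial (Fin n × Fin n) ℂ)} {A B : Finset (Fin n)} {x y : Fin n} (hA : swap x y • A ≠ A) :
    ((L.filter fun ℓ => R ℓ = A ∧ C ℓ = B).filter fun ℓ => ren (swap x y) ℓ = -ℓ) = 0 := by
  rw [Multiset.filter_eq_nil]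
  intro ℓ hℓ hneg
  obtain ⟨-, hR, -⟩ := Multiset.mem_filter.1 hℓ
  have h1 : R (ren (swap x y) ℓ) = R ℓ := by
    rw [hneg, show (-ℓ : MvPolynomial (Fin n × Fin n) ℂ) = MvPolynomial.C (-1) * ℓ by
      rw [map_neg, map_one]; ring]
    exact R1 ℓ (-1) (by norm_num)
  rw [R3, hR] at h1
  exact hA h1

/-- **No diagonal negation when the transposition MOVES the column support.** [folklore] -/
theorem filter_diag_eq_zero_of_col_moved (R C : MvPolynomial (Fin n × Fin n) ℂ → Finset (Fin n))
    (C1 : ∀ (q : MvPolynomial (Fin n × Fin n) ℂ) (u : ℂ), u ≠ 0 → C (MvPolynomial.C u * q) = C q)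
    (C3 : ∀ (q : MvPolynomial (Fin n × Fin n) ℂ) (σ : Perm (Fin n)), C (ren σ q) = σ • C q)
    {L : Multiset (MvPolynomial (Fin n × Fin n) ℂ)} {A B : Finset (Fin n)} {x y : Fin n} (hB : swap x y • B ≠ B) :
    ((L.filter fun ℓ => R ℓ = A ∧ C ℓ = B).filter fun ℓ => ren (swap x y) ℓ = -ℓ) = 0 := by
  rw [Multiset.filter_eq_nil]
  intro ℓ hℓ hneg
  obtain ⟨-, -, hC⟩ := Multiset.mem_filter.1 hℓ
  have h1 : C (ren (swap x y) ℓ) = C ℓ := by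
    rw [hneg, show (-ℓ : MvPolynomial (Fin n × Fin n) ℂ) = MvPolynomial.C (-1) * ℓ by
      rw [map_neg, map_one]; ring]
    exact C1 ℓ (-1) (by norm_num)
  rw [C3, hC] at h1
  exact hB h1

end FibreSigns

end Summit.ValiantsHypothesis.ValiantsHypothesis.Theorems

end
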